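/-
Copyright: statement-level skeleton of a published paper (lit-balaban cell, Phase-2 proof seat p39 gen 7). No proof claims
beyond what the kernel checks below.
-/
import Literature.MathematicalPhysics.QuantumFieldTheory.Balaban1983to89.B3TorusRadialTails

/-!
# B3 — T. Bałaban, *(Higgs)₂,₃ quantum fields in a finite volume. III. Renormalization*, CMP **88** (1983) 411–445
[Balaban1983Higgs3], p. 441 [PDF 31] with p. 437 [PDF 27]: the SHARP LATTICE CONVOLUTION ESTIMATE behind *"If at least one
propagator G_{j₀}(0) is replaced by G_{j₀}(0)(1 − m²_{j₀} − a_{j₀}P_{j₀})C^ξ, then we get a convergent expression"* (the vector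
self-energy functions Π_{μμ′}, Π_{μμ′ν} of (3.26)–(3.30)): on the `ξ`-lattice torus in `d = 3`, two kernels with the
`|y − z|^{−2}e^{−c|y−z|}` singularity of a DIFFERENTIATED propagator convolve to a kernel bounded by `O(1)|y − y′|^{−1}e^{−γ|y−y′|}`
(the lattice form of the Riesz composition `|u|^{−2} ∗ |u|^{−2} = c|u|^{−1}` in three dimensions), uniformly in the spacing
`0 < ξ` and in the volume — the SHARP form of this seat's gen-6 `B3KernelConvolutionTorus.conv_le_offdiag` (which kept `|y − y′|^{−2}`)

statement-level skeleton of published theorems with citation tags; proofs where landed; nothing here is a claim about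
the Yang–Mills mass gap

PDF held: `paper:balaban1983-higgs-2-3-quantum-fields-finite-volume` (journal page = PDF page + 410); pp. 437, 441 read on the
×2 renders `run/shared/lean/pub/pub-balaban/b2b-balaban-ref1/pages/1983-cmp88-higgs23-III/1983-cmp88-higgs23-III-p027-x2.png`,
`…-p031-x2.png`.  Row **B3.Eq3.25-3.32** of `HOME/lit-balaban-r15/ROWS-B3.md` (fold owner r15): p. 441 [PDF 31] *"Next we replace the
propagator G_{j₀}(0) by C^ξ, ξ = L^{−j₀}, using the same equation as in (3.16). If at least one propagator G_{j₀}(0) is replaced by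
G_{j₀}(0)(1 − m²_{j₀} − a_{j₀}P_{j₀})C^ξ, then we get a convergent expression."*; p. 437 [PDF 27]: *"Using the inequalities
|C^ξ(y − y′)| ≦ O(1)e^{−½|y−y′|}/|y − y′|, |G^ξ_{j″}(0; y, y′)| ≦ O(1)e^{−δ₀|y−y′|}/|y − y′|, and the corresponding inequalities for
derivatives, we can estimate (3.16) by a constant."*  This seat's gen 7 proves the p. 441 sentence for the vector self-energy
functions Π_{μμ′}, Π_{μμ′ν} of (3.26)–(3.30) at the zero-field torus instance; the present file is part of its MODEL-FREE toolkit
(kernels on a torus level `Site P j`, volume element `ξ^d`, `d = 3`, "`p`-profiles" `(ξ·max(1,|y − z|_∞))^{−p}e^{−cξ|y−z|_∞}`,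
`|·|_∞` = `supDist` in lattice steps).
* **`conv22_le`** — TWO 2-PROFILES CONVOLVE TO A 1-PROFILE: if `|A(y,z)| ≤ a(ξ max(1,|y−z|))^{−2}e^{−αξ|y−z|}` and
  `|B(z,y′)| ≤ b(…)^{−2}e^{−βξ|z−y′|}` at all sites, then for ALL `y, y′` and every `0 ≤ γ`, `2γ ≤ α`, `2γ ≤ β`:
  `Σ_z ξ³|A(y,z)||B(z,y′)| ≤ 6205·ab·(ξ·max(1,|y−y′|))^{−1}e^{−γξ|y−y′|}`.  Mechanism (`y′ ≠ y`, `n = |y − y′|`): where `|y − z| > 2n`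
  both factors carry the distance `|y − z|` and the tail `Σ_{|y−z|>2n}ξ³(ξ|y−z|)^{−4} = O((ξn)^{−1})` of `B3TorusRadialTails` appears;
  where `|y − z| ≤ 2n` one factor carries half of `n` (a factor `(ξn)^{−2}`) and the other is summed over a ball, `O(ξn)`.
  This is what the mixed second differences `∂^ξ_{μ′}M∂^{ξ*}_μ` of `M = G(0)(1 − m² − aP)C^ξ` need on p. 441.
File 2 of this seat's gen-7 toolkit (1: `B3TorusRadialTails`, 3: `B3KernelConvolutionTorusOneTwo`, 4: `B3KernelBlockSmearing`).
Mathlib + the cited tree files only; theorems only, no definitions, no named facts; standard axioms.  Unit `lit-balaban-p39-g7` (Phase-2 proof seat p39, gen 7),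
HOME `run/shared/lean/pub/lit-balaban/`, 2026-08-21.
-/

open scoped BigOperators

namespace Literature.MathematicalPhysics.QuantumFieldTheory.Balaban1983to89.B3KernelConvolutionTorusSharp

open LatticeFieldCalculus B3Sect3ScalarSelfEnergy B3TorusRadialSums B3Bound316 B3KernelConvolutionTorus B3TorusRadialTails

noncomputable section

variable {P : Params} {j : ℕ}

/-! ## Two `|y − z|^{−2}`-kernels convolve to a `|y − y′|^{−1}`-kernel -/

/-- **TWO 2-PROFILES CONVOLVE TO A 1-PROFILE** (`d = 3`, volume element `ξ³`, `0 < ξ`): if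
`|A(y,z)| ≤ a(ξ·max(1,|y−z|))^{−2}e^{−αξ|y−z|}` and `|B(z,y′)| ≤ b(ξ·max(1,|z−y′|))^{−2}e^{−βξ|z−y′|}` at ALL sites, then for ALL
`y, y′` and every `0 ≤ γ` with `2γ ≤ α`, `2γ ≤ β`:
`Σ_z ξ³|A(y,z)||B(z,y′)| ≤ 6205·ab·(ξ·max(1,|y−y′|))^{−1}e^{−γξ|y−y′|}` — the lattice Riesz composition `|u|^{−2} ∗ |u|^{−2} ≲ |u|^{−1}`
with exponential tails, uniformly in the volume; the sharp form of `B3KernelConvolutionTorus.conv_le_offdiag`, used for the mixed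
second differences `∂^ξ_{μ′}M∂^{ξ*}_μ` of `M = G(0)(1 − m² − aP)C^ξ` (p. 441). [cite: Balaban1983Higgs3, (3.16) p.437] -/
theorem conv22_le (hd : P.d = 3) {ξ : ℝ} (hξ : 0 < ξ) {α β γ a b : ℝ} (hα : 0 < α) (hβ : 0 < β)
    (hγ : 0 ≤ γ) (hγα : 2 * γ ≤ α) (hγβ : 2 * γ ≤ β) (ha : 0 ≤ a) (hb : 0 ≤ b) (A B : Kernel P j)
    (hA : ∀ y z : Site P j, |A y z| ≤
      a * (((ξ * max (1 : ℝ) (supDist y z : ℝ)) ^ 2)⁻¹ * Real.exp (-(α * (ξ * (supDist y z : ℝ))))))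
    (hB : ∀ z y' : Site P j, |B z y'| ≤
      b * (((ξ * max (1 : ℝ) (supDist z y' : ℝ)) ^ 2)⁻¹ * Real.exp (-(β * (ξ * (supDist z y' : ℝ))))))
    (y y' : Site P j) :
    ∑ z : Site P j, ξ ^ P.d * (|A y z| * |B z y'|) ≤
      6205 * a * b * ((ξ * max (1 : ℝ) (supDist y y' : ℝ))⁻¹ * Real.exp (-(γ * (ξ * (supDist y y' : ℝ))))) := by
  classical
  have hξd : 0 ≤ ξ ^ P.d := by positivity
  -- an exponential with a nonnegative argument is at most one
  have hexp1 : ∀ {c : ℝ} (_ : 0 ≤ c) (m : ℕ), Real.exp (-(c * (ξ * (m : ℝ)))) ≤ 1 := by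
    intro c hc m
    apply Real.exp_le_one_iff.mpr
    have : 0 ≤ c * (ξ * (m : ℝ)) := by positivity
    linarith
  by_cases hne : y' = y
  · -- the diagonal: `Σ_z ξ³(ξ max(1,|y−z|))^{−4} ≤ 109ξ^{−1}`
    subst hne
    have hM1 : max (1 : ℝ) (supDist y' y' : ℝ) = 1 := max_one_supDist_self y'
    have hs0 : (supDist y' y' : ℝ) = 0 := by rw [(supDist_eq_zero_iff y' y').mpr rfl, Nat.cast_zero]
    rw [hM1, hs0]
    simp only [mul_zero, neg_zero, Real.exp_zero, mul_one]
    have hpt : ∀ z : Site P j, ξ ^ P.d * (|A y' z| * |B z y'|) ≤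
        a * b * (ξ ^ P.d * ((ξ * max (1 : ℝ) (supDist y' z : ℝ)) ^ 4)⁻¹) := by
      intro z
      have h1 := hA y' z
      have h2 := hB z y'
      rw [supDist_comm z y'] at h2
      have hM0 : 0 < ξ * max (1 : ℝ) (supDist y' z : ℝ) := by positivity
      have h1' : |A y' z| ≤ a * ((ξ * max (1 : ℝ) (supDist y' z : ℝ)) ^ 2)⁻¹ := h1.trans (by
        have := mul_le_mul_of_nonneg_left (hexp1 hα.le (supDist y' z))
          (show 0 ≤ a * ((ξ * max (1 : ℝ) (supDist y' z : ℝ)) ^ 2)⁻¹ by positivity)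
        rw [mul_one, mul_assoc] at this; exact this)
      have h2' : |B z y'| ≤ b * ((ξ * max (1 : ℝ) (supDist y' z : ℝ)) ^ 2)⁻¹ := h2.trans (by
        have := mul_le_mul_of_nonneg_left (hexp1 hβ.le (supDist y' z))
          (show 0 ≤ b * ((ξ * max (1 : ℝ) (supDist y' z : ℝ)) ^ 2)⁻¹ by positivity)
        rw [mul_one, mul_assoc] at this; exact this)
      calc ξ ^ P.d * (|A y' z| * |B z y'|) ≤ ξ ^ P.d * ((a * ((ξ * max (1 : ℝ) (supDist y' z : ℝ)) ^ 2)⁻¹) *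
            (b * ((ξ * max (1 : ℝ) (supDist y' z : ℝ)) ^ 2)⁻¹)) :=
            mul_le_mul_of_nonneg_left (mul_le_mul h1' h2' (abs_nonneg _) (by positivity)) hξd
        _ = a * b * (ξ ^ P.d * ((ξ * max (1 : ℝ) (supDist y' z : ℝ)) ^ 4)⁻¹) := by
            have : ((ξ * max (1 : ℝ) (supDist y' z : ℝ)) ^ 4)⁻¹ = ((ξ * max (1 : ℝ) (supDist y' z : ℝ)) ^ 2)⁻¹ *
                ((ξ * max (1 : ℝ) (supDist y' z : ℝ)) ^ 2)⁻¹ := by rw [← mul_inv, ← pow_add]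
            rw [this]; ring
    calc ∑ z : Site P j, ξ ^ P.d * (|A y' z| * |B z y'|)
        ≤ ∑ z : Site P j, a * b * (ξ ^ P.d * ((ξ * max (1 : ℝ) (supDist y' z : ℝ)) ^ 4)⁻¹) :=
          Finset.sum_le_sum fun z _ => hpt z
      _ = a * b * ∑ z : Site P j, ξ ^ P.d * ((ξ * max (1 : ℝ) (supDist y' z : ℝ)) ^ 4)⁻¹ := by rw [Finset.mul_sum]
      _ ≤ a * b * (109 * ξ⁻¹) := mul_le_mul_of_nonneg_left (sum_inv_four_le hd hξ y') (mul_nonneg ha hb)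
      _ ≤ 6205 * a * b * ξ⁻¹ := by nlinarith [mul_nonneg (mul_nonneg ha hb) (inv_nonneg.mpr hξ.le)]
  · -- off the diagonal
    have hn1 : 1 ≤ supDist y y' := by
      by_contra h0
      exact hne (((supDist_eq_zero_iff y y').mp (by omega)).symm)
    have hn0 : (0 : ℝ) < (supDist y y' : ℝ) := by exact_mod_cast hn1
    have hnr1 : (1 : ℝ) ≤ (supDist y y' : ℝ) := by exact_mod_cast hn1
    rw [max_one_supDist_of_ne hne]
    obtain ⟨t, ht⟩ : ∃ t : ℝ, t = ξ * (supDist y y' : ℝ) := ⟨_, rfl⟩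
    rw [← ht]
    have ht0 : 0 < t := by rw [ht]; exact mul_pos hξ hn0
    -- the three majorants
    obtain ⟨u₁, hu₁⟩ : ∃ u : Site P j → ℝ, u = fun z =>
        if 2 * supDist y y' < supDist y z then ξ ^ P.d * ((ξ * (supDist y z : ℝ)) ^ 4)⁻¹ else 0 := ⟨_, rfl⟩
    obtain ⟨u₂, hu₂⟩ : ∃ u : Site P j → ℝ, u = fun z =>
        if supDist y z ≤ 2 * supDist y y' then ξ ^ P.d * ((ξ * max (1 : ℝ) (supDist y z : ℝ)) ^ 2)⁻¹ else 0 :=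
      ⟨_, rfl⟩
    obtain ⟨u₃, hu₃⟩ : ∃ u : Site P j → ℝ, u = fun z =>
        if supDist z y' ≤ 2 * supDist y y' then ξ ^ P.d * ((ξ * max (1 : ℝ) (supDist z y' : ℝ)) ^ 2)⁻¹ else 0 :=
      ⟨_, rfl⟩
    have hu₁0 : ∀ z, 0 ≤ u₁ z := fun z => by rw [hu₁]; dsimp only; split_ifs <;> positivity
    have hu₂0 : ∀ z, 0 ≤ u₂ z := fun z => by rw [hu₂]; dsimp only; split_ifs <;> positivity
    have hu₃0 : ∀ z, 0 ≤ u₃ z := fun z => by rw [hu₃]; dsimp only; split_ifs <;> positivity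
    obtain ⟨W₁, hW₁⟩ : ∃ W : ℝ, W = 4 * a * b * Real.exp (-(γ * t)) := ⟨_, rfl⟩
    obtain ⟨W₂, hW₂⟩ : ∃ W : ℝ, W = 4 * a * b * (t ^ 2)⁻¹ * Real.exp (-(γ * t)) := ⟨_, rfl⟩
    have hW₁0 : 0 ≤ W₁ := by rw [hW₁]; positivity
    have hW₂0 : 0 ≤ W₂ := by rw [hW₂]; positivity
    -- `(ξm/2)^{−2} = 4(ξm)^{−2}`-type identities
    have four_inv : ∀ s : ℝ, 4 * (s ^ 2)⁻¹ = ((s / 2) ^ 2)⁻¹ := by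
      intro s; rw [div_pow, inv_div, div_eq_mul_inv]; ring
    -- pointwise casework
    have hpt : ∀ z : Site P j, ξ ^ P.d * (|A y z| * |B z y'|) ≤ W₁ * u₁ z + W₂ * u₂ z + W₂ * u₃ z := by
      intro z
      have htri1 : supDist y y' ≤ supDist y z + supDist z y' := supDist_triangle' y z y'
      have htri2 : supDist y z ≤ supDist y y' + supDist z y' := by
        have := supDist_triangle' y y' z; rw [supDist_comm y' z] at this; exact this
      have hAz := hA y z
      have hBz := hB z y'
      have hp0 : (0 : ℝ) ≤ (supDist y z : ℝ) := by positivity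
      have hq0 : (0 : ℝ) ≤ (supDist z y' : ℝ) := by positivity
      by_cases h1 : 2 * supDist y y' < supDist y z
      · -- both factors carry `|y − z|`: the tail term
        have hp3 : (1 : ℝ) ≤ (supDist y z : ℝ) := by exact_mod_cast (show 1 ≤ supDist y z by omega)
        have hq1 : (1 : ℝ) ≤ (supDist z y' : ℝ) := by exact_mod_cast (show 1 ≤ supDist z y' by omega)
        have hq2 : (supDist y z : ℝ) ≤ 2 * (supDist z y' : ℝ) := by
          exact_mod_cast (show supDist y z ≤ 2 * supDist z y' by omega)
        have hpn : (supDist y y' : ℝ) ≤ (supDist y z : ℝ) := by exact_mod_cast (show supDist y y' ≤ supDist y z by omega)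
        rw [max_eq_right hp3] at hAz
        rw [max_eq_right hq1] at hBz
        have he1 : Real.exp (-(α * (ξ * (supDist y z : ℝ)))) ≤ Real.exp (-(γ * t)) := by
          apply Real.exp_le_exp.mpr
          have h3 : γ ≤ α := by linarith
          have h4 : γ * (ξ * (supDist y y' : ℝ)) ≤ α * (ξ * (supDist y z : ℝ)) :=
            calc γ * (ξ * (supDist y y' : ℝ)) ≤ α * (ξ * (supDist y y' : ℝ)) :=
                  mul_le_mul_of_nonneg_right h3 (by positivity)
              _ ≤ α * (ξ * (supDist y z : ℝ)) :=
                  mul_le_mul_of_nonneg_left (mul_le_mul_of_nonneg_left hpn hξ.le) hα.le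
          rw [ht]; linarith
        have hpq : ((ξ * (supDist z y' : ℝ)) ^ 2)⁻¹ ≤ 4 * ((ξ * (supDist y z : ℝ)) ^ 2)⁻¹ := by
          rw [four_inv]
          apply inv_anti₀ (by positivity)
          have : ξ * (supDist y z : ℝ) / 2 ≤ ξ * (supDist z y' : ℝ) := by
            have := mul_le_mul_of_nonneg_left hq2 hξ.le; linarith
          exact pow_le_pow_left₀ (by positivity) this 2
        have hA' : |A y z| ≤ a * ((ξ * (supDist y z : ℝ)) ^ 2)⁻¹ * Real.exp (-(γ * t)) := by
          refine hAz.trans ?_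
          rw [mul_assoc]
          exact mul_le_mul_of_nonneg_left (mul_le_mul_of_nonneg_left he1 (by positivity)) ha
        have hB' : |B z y'| ≤ b * (4 * ((ξ * (supDist y z : ℝ)) ^ 2)⁻¹) := by
          refine hBz.trans (mul_le_mul_of_nonneg_left ?_ hb)
          calc ((ξ * (supDist z y' : ℝ)) ^ 2)⁻¹ * Real.exp (-(β * (ξ * (supDist z y' : ℝ))))
              ≤ ((ξ * (supDist z y' : ℝ)) ^ 2)⁻¹ * 1 :=
                mul_le_mul_of_nonneg_left (hexp1 hβ.le (supDist z y')) (by positivity)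
            _ ≤ 4 * ((ξ * (supDist y z : ℝ)) ^ 2)⁻¹ := by rw [mul_one]; exact hpq
        have hu : u₁ z = ξ ^ P.d * ((ξ * (supDist y z : ℝ)) ^ 4)⁻¹ := by rw [hu₁]; dsimp only; rw [if_pos h1]
        calc ξ ^ P.d * (|A y z| * |B z y'|)
            ≤ ξ ^ P.d * ((a * ((ξ * (supDist y z : ℝ)) ^ 2)⁻¹ * Real.exp (-(γ * t))) *
                (b * (4 * ((ξ * (supDist y z : ℝ)) ^ 2)⁻¹))) :=
              mul_le_mul_of_nonneg_left (mul_le_mul hA' hB' (abs_nonneg _) (by positivity)) hξd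
          _ = W₁ * u₁ z := by
              rw [hu, hW₁]
              have : ((ξ * (supDist y z : ℝ)) ^ 4)⁻¹ =
                  ((ξ * (supDist y z : ℝ)) ^ 2)⁻¹ * ((ξ * (supDist y z : ℝ)) ^ 2)⁻¹ := by
                rw [← mul_inv, ← pow_add]
              rw [this]; ring
          _ ≤ W₁ * u₁ z + W₂ * u₂ z + W₂ * u₃ z := by
              have := mul_nonneg hW₂0 (hu₂0 z); have := mul_nonneg hW₂0 (hu₃0 z); linarith
      · push Not at h1
        by_cases h2 : supDist y y' ≤ 2 * supDist z y'
        · -- `B` carries half of `n`, `A` is summed over the ball `|y − z| ≤ 2n`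
          have hq1 : (1 : ℝ) ≤ (supDist z y' : ℝ) := by exact_mod_cast (show 1 ≤ supDist z y' by omega)
          rw [max_eq_right hq1] at hBz
          have hnq : (supDist y y' : ℝ) ≤ 2 * (supDist z y' : ℝ) := by exact_mod_cast h2
          have hqt : ((ξ * (supDist z y' : ℝ)) ^ 2)⁻¹ ≤ 4 * (t ^ 2)⁻¹ := by
            rw [four_inv]
            apply inv_anti₀ (by positivity)
            have : t / 2 ≤ ξ * (supDist z y' : ℝ) := by
              rw [ht]; have := mul_le_mul_of_nonneg_left hnq hξ.le; linarith
            exact pow_le_pow_left₀ (by positivity) this 2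
          have he2 : Real.exp (-(β * (ξ * (supDist z y' : ℝ)))) ≤ Real.exp (-(γ * t)) := by
            apply Real.exp_le_exp.mpr
            have h4 : γ * (ξ * (supDist y y' : ℝ)) ≤ β * (ξ * (supDist z y' : ℝ)) :=
              calc γ * (ξ * (supDist y y' : ℝ)) ≤ γ * (ξ * (2 * (supDist z y' : ℝ))) := by gcongr
                _ = (2 * γ) * (ξ * (supDist z y' : ℝ)) := by ring
                _ ≤ β * (ξ * (supDist z y' : ℝ)) := mul_le_mul_of_nonneg_right hγβ (by positivity)
            rw [ht]; linarith
          have hA' : |A y z| ≤ a * ((ξ * max (1 : ℝ) (supDist y z : ℝ)) ^ 2)⁻¹ := by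
            refine hAz.trans (mul_le_mul_of_nonneg_left ?_ ha)
            calc ((ξ * max (1 : ℝ) (supDist y z : ℝ)) ^ 2)⁻¹ * Real.exp (-(α * (ξ * (supDist y z : ℝ))))
                ≤ ((ξ * max (1 : ℝ) (supDist y z : ℝ)) ^ 2)⁻¹ * 1 :=
                  mul_le_mul_of_nonneg_left (hexp1 hα.le (supDist y z)) (by positivity)
              _ = _ := mul_one _
          have hB' : |B z y'| ≤ b * (4 * (t ^ 2)⁻¹ * Real.exp (-(γ * t))) := by
            refine hBz.trans (mul_le_mul_of_nonneg_left ?_ hb)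
            exact mul_le_mul hqt he2 (Real.exp_pos _).le (by positivity)
          have hu : u₂ z = ξ ^ P.d * ((ξ * max (1 : ℝ) (supDist y z : ℝ)) ^ 2)⁻¹ := by
            rw [hu₂]; dsimp only; rw [if_pos h1]
          calc ξ ^ P.d * (|A y z| * |B z y'|)
              ≤ ξ ^ P.d * ((a * ((ξ * max (1 : ℝ) (supDist y z : ℝ)) ^ 2)⁻¹) *
                  (b * (4 * (t ^ 2)⁻¹ * Real.exp (-(γ * t))))) :=
                mul_le_mul_of_nonneg_left (mul_le_mul hA' hB' (abs_nonneg _) (by positivity)) hξd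
            _ = W₂ * u₂ z := by rw [hu, hW₂]; ring
            _ ≤ W₁ * u₁ z + W₂ * u₂ z + W₂ * u₃ z := by
                have := mul_nonneg hW₁0 (hu₁0 z); have := mul_nonneg hW₂0 (hu₃0 z); linarith
        · -- `A` carries half of `n`, `B` is summed over the ball `|z − y′| ≤ 2n`
          push Not at h2
          have hp1 : (1 : ℝ) ≤ (supDist y z : ℝ) := by exact_mod_cast (show 1 ≤ supDist y z by omega)
          rw [max_eq_right hp1] at hAz
          have hnp : (supDist y y' : ℝ) ≤ 2 * (supDist y z : ℝ) := by
            exact_mod_cast (show supDist y y' ≤ 2 * supDist y z by omega)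
          have hq3 : supDist z y' ≤ 2 * supDist y y' := by omega
          have hpt' : ((ξ * (supDist y z : ℝ)) ^ 2)⁻¹ ≤ 4 * (t ^ 2)⁻¹ := by
            rw [four_inv]
            apply inv_anti₀ (by positivity)
            have : t / 2 ≤ ξ * (supDist y z : ℝ) := by
              rw [ht]; have := mul_le_mul_of_nonneg_left hnp hξ.le; linarith
            exact pow_le_pow_left₀ (by positivity) this 2
          have he1 : Real.exp (-(α * (ξ * (supDist y z : ℝ)))) ≤ Real.exp (-(γ * t)) := by
            apply Real.exp_le_exp.mpr
            have h4 : γ * (ξ * (supDist y y' : ℝ)) ≤ α * (ξ * (supDist y z : ℝ)) :=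
              calc γ * (ξ * (supDist y y' : ℝ)) ≤ γ * (ξ * (2 * (supDist y z : ℝ))) := by gcongr
                _ = (2 * γ) * (ξ * (supDist y z : ℝ)) := by ring
                _ ≤ α * (ξ * (supDist y z : ℝ)) := mul_le_mul_of_nonneg_right hγα (by positivity)
            rw [ht]; linarith
          have hA' : |A y z| ≤ a * (4 * (t ^ 2)⁻¹ * Real.exp (-(γ * t))) := by
            refine hAz.trans (mul_le_mul_of_nonneg_left ?_ ha)
            exact mul_le_mul hpt' he1 (Real.exp_pos _).le (by positivity)
          have hB' : |B z y'| ≤ b * ((ξ * max (1 : ℝ) (supDist z y' : ℝ)) ^ 2)⁻¹ := by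
            refine hBz.trans (mul_le_mul_of_nonneg_left ?_ hb)
            calc ((ξ * max (1 : ℝ) (supDist z y' : ℝ)) ^ 2)⁻¹ * Real.exp (-(β * (ξ * (supDist z y' : ℝ))))
                ≤ ((ξ * max (1 : ℝ) (supDist z y' : ℝ)) ^ 2)⁻¹ * 1 :=
                  mul_le_mul_of_nonneg_left (hexp1 hβ.le (supDist z y')) (by positivity)
              _ = _ := mul_one _
          have hu : u₃ z = ξ ^ P.d * ((ξ * max (1 : ℝ) (supDist z y' : ℝ)) ^ 2)⁻¹ := by
            rw [hu₃]; dsimp only; rw [if_pos hq3]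
          calc ξ ^ P.d * (|A y z| * |B z y'|)
              ≤ ξ ^ P.d * ((a * (4 * (t ^ 2)⁻¹ * Real.exp (-(γ * t)))) *
                  (b * ((ξ * max (1 : ℝ) (supDist z y' : ℝ)) ^ 2)⁻¹)) :=
                mul_le_mul_of_nonneg_left (mul_le_mul hA' hB' (abs_nonneg _) (by positivity)) hξd
            _ = W₂ * u₃ z := by rw [hu, hW₂]; ring
            _ ≤ W₁ * u₁ z + W₂ * u₂ z + W₂ * u₃ z := by
                have := mul_nonneg hW₁0 (hu₁0 z); have := mul_nonneg hW₂0 (hu₂0 z); linarith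
    -- the three sums
    have hs₁ : ∑ z, u₁ z ≤ 54 * t⁻¹ := by
      rw [hu₁, ← Finset.sum_filter]
      have h := sum_ge_inv_four_le hd hξ y (R := 2 * supDist y y' + 1) (by omega)
      have hset : Finset.univ.filter (fun z : Site P j => 2 * supDist y y' < supDist y z) =
          Finset.univ.filter (fun z : Site P j => 2 * supDist y y' + 1 ≤ supDist y z) := by
        ext z; simp only [Finset.mem_filter, Finset.mem_univ, true_and]; omega
      rw [hset]
      refine h.trans ?_
      have h2n : (2 : ℝ) * (supDist y y' : ℝ) ≤ ((2 * supDist y y' + 1 : ℕ) : ℝ) := by push_cast; linarith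
      have h0 : (0 : ℝ) < ((2 * supDist y y' + 1 : ℕ) : ℝ) := by positivity
      rw [div_le_iff₀ h0, ht, mul_inv]
      calc 108 * ξ⁻¹ = 54 * (ξ⁻¹ * ((supDist y y' : ℝ))⁻¹) * (2 * (supDist y y' : ℝ)) := by field_simp; ring
        _ ≤ 54 * (ξ⁻¹ * ((supDist y y' : ℝ))⁻¹) * ((2 * supDist y y' + 1 : ℕ) : ℝ) :=
            mul_le_mul_of_nonneg_left h2n (by positivity)
    have hs₂ : ∑ z, u₂ z ≤ 735 * t := by
      rw [hu₂, ← Finset.sum_filter, ht]; exact sum_ball_profile_two_le hd hξ y hn1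
    have hs₃ : ∑ z, u₃ z ≤ 735 * t := by
      rw [hu₃, ← Finset.sum_filter, ht]; exact sum_ball_profile_two_le' hd hξ y' hn1
    -- assembly
    have hsum : ∑ z : Site P j, ξ ^ P.d * (|A y z| * |B z y'|) ≤
        W₁ * (54 * t⁻¹) + W₂ * (735 * t) + W₂ * (735 * t) := by
      calc ∑ z : Site P j, ξ ^ P.d * (|A y z| * |B z y'|) ≤ ∑ z, (W₁ * u₁ z + W₂ * u₂ z + W₂ * u₃ z) :=
            Finset.sum_le_sum fun z _ => hpt z
        _ = W₁ * ∑ z, u₁ z + W₂ * ∑ z, u₂ z + W₂ * ∑ z, u₃ z := by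
            rw [Finset.sum_add_distrib, Finset.sum_add_distrib, Finset.mul_sum, Finset.mul_sum, Finset.mul_sum]
        _ ≤ W₁ * (54 * t⁻¹) + W₂ * (735 * t) + W₂ * (735 * t) := by gcongr
    refine hsum.trans ?_
    rw [hW₁, hW₂]
    have key : 4 * a * b * Real.exp (-(γ * t)) * (54 * t⁻¹) + 4 * a * b * (t ^ 2)⁻¹ * Real.exp (-(γ * t)) * (735 * t) +
        4 * a * b * (t ^ 2)⁻¹ * Real.exp (-(γ * t)) * (735 * t) = 6096 * a * b * (t⁻¹ * Real.exp (-(γ * t))) := by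
      field_simp
      ring
    rw [key]
    have h0 : 0 ≤ a * b * (t⁻¹ * Real.exp (-(γ * t))) := by positivity
    nlinarith

end

end Literature.MathematicalPhysics.QuantumFieldTheory.Balaban1983to89.B3KernelConvolutionTorusSharp
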